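import Summits.CriticalPhenomena.PercolationContinuityZ3.Theorems.PercNearOneGluingNoHeavyLowerTailAntitheticCycleOplusBoxes
import Summits.CriticalPhenomena.PercolationContinuityZ3.Theorems.PercNearOneGluingNoHeavyLowerTailAntitheticBoxes
import HarnessLib

/-!
# `NoHeavyLowerTail` (stmt-CriticalPhenomena-4575) — antithetic cluster pairs: THEOREM ⊕-CYCLE — a cycle through the source, with a pendant
# stub, is ⊕-POSITIVE at every cycle vertex (HOME/THEOREM-Theta.md §2, prim-hp-2 gen 62)

Support file (`--supports stmt-CriticalPhenomena-4575`, hull-port prover `prim-hp-2`, gen 62).  No definitions, no named facts, no sorries;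
standard axioms.  Setting of …AntitheticCycleRuns / …AntitheticCycleOplusBoxes: cycle `v 0 = s, …, v (n-1)` (`n ≥ 3`), `P = v p` with
`0 < p < n`; in addition a PENDANT STUB `w 0 = v q, w 1, …, w b` of fresh vertices hanging at a cycle vertex `v q` (pairs `Cyc.edgeSet j w`,
`j ≤ b`; `j = 0` is the bare cycle).  `E_j = Cyc.edgeSet n v ∪ Cyc.edgeSet j w`, `X ω = openCluster (ω ∩ E_j) s`, `Y ω = openCluster (ωᶜ ∩ E_j) s`.

**THEOREM ⊕-CYCLE** (`Antithetic.Cyc.oplus_cycle_stub`): for every `j ≤ b` and all super-odd twisted-monotone `K₁, K₂ : Set V → Set V → ℝ`,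
`0 ≤ Σ_{ω : P ∈ X ω} K₁(X ω, Y ω)·K₂(X ω, Y ω)`
— i.e. `(E_j, s, P)` is ⊕-positive in the sense of `Antithetic.oplus_composition_sum_nonneg` (indeed in the class 𝒦⁺: the event `{P ∈ X}` is the
disjoint union of the red-dominated boxes of …AntitheticCycleOplusBoxes, the stub pairs being free coordinates of every box —
`Antithetic.Box.boxes_sum_nonneg`, `Antithetic.Box.mem_path_iff`, `Antithetic.Box.dom_path`).  This is the ⊕-input of the pendant split PR2
(`Antithetic.Pendant.termTwo_pendant_split`) in THEOREM Θ (Δ2 for a handle on a cycle).  Cones are NOT all ⊕-positive (THEOREM FAN,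
HOME/THEOREM-Fans.md: the 6-fan), so this is a genuinely cycle-specific fact.
[cite: VandenbergHaggstromKahn2005, §1 p. 6 ("Harris' inequality"), §1 p. 3 (open cluster `C_s`)]
-/

noncomputable section

namespace Summit.CriticalPhenomena.PercolationContinuityZ3.Theorems

open Literature.Probability.Percolation
open scoped Classical

namespace Antithetic

namespace Cyc

variable {V : Type*} [Fintype V] {n : ℕ} {v : ℕ → V} (hn : 3 ≤ n) (hinj : ∀ i j, i < n → j < n → v i = v j → i = j) (hper : v n = v 0)
  {p : ℕ} (hp0 : 0 < p) (hpn : p < n)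
  {w : ℕ → V} {b : ℕ} (hfresh : ∀ i, 0 < i → i ≤ b → ∀ f ∈ edgeSet n v, w i ∈ f → f.IsDiag)
  (hwinj : ∀ i j, i ≤ b → j ≤ b → w i = w j → i = j) (hsw : ∀ i, 0 < i → i ≤ b → v 0 ≠ w i) (hPw : ∀ i, 0 < i → i ≤ b → v p ≠ w i)
include hn hinj hper hp0 hpn hfresh hwinj hsw hPw

/-- **THEOREM ⊕-CYCLE** (HOME/THEOREM-Theta.md §2): the cycle through `s = v 0` together with a pendant stub `w 0 = v q, …, w j` (`j ≤ b`,
fresh vertices; `j = 0` = bare cycle) is ⊕-POSITIVE at every cycle vertex `P = v p`, `0 < p < n`: for all super-odd twisted-monotone `K₁, K₂`,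
`0 ≤ Σ_{ω : P ∈ X ω} K₁(X ω, Y ω)·K₂(X ω, Y ω)` with `X, Y` the red/blue clusters of `s` for `E = Cyc.edgeSet n v ∪ Cyc.edgeSet j w`. [this work] -/
theorem oplus_cycle_stub {j : ℕ} (hj : j ≤ b) (K₁ K₂ : Set V → Set V → ℝ)
    (hK₁ : ∀ ⦃P P' Q Q' : Set V⦄, P ⊆ P' → Q' ⊆ Q → K₁ P Q ≤ K₁ P' Q') (hso₁ : ∀ P Q, 0 ≤ K₁ P Q + K₁ Q P)
    (hK₂ : ∀ ⦃P P' Q Q' : Set V⦄, P ⊆ P' → Q' ⊆ Q → K₂ P Q ≤ K₂ P' Q') (hso₂ : ∀ P Q, 0 ≤ K₂ P Q + K₂ Q P) :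
    0 ≤ ∑ ω ∈ Finset.univ.filter (fun ω : Set (Sym2 V) => v p ∈ openCluster (ω ∩ (edgeSet n v ∪ edgeSet j w)) (v 0)),
      K₁ (openCluster (ω ∩ (edgeSet n v ∪ edgeSet j w)) (v 0)) (openCluster (ωᶜ ∩ (edgeSet n v ∪ edgeSet j w)) (v 0)) *
        K₂ (openCluster (ω ∩ (edgeSet n v ∪ edgeSet j w)) (v 0)) (openCluster (ωᶜ ∩ (edgeSet n v ∪ edgeSet j w)) (v 0)) := by
  -- the boxes, indexed by `Fin (n+1)`: `c = n` the TOP box, `c = k < n` BOX `k`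
  let arc : ℕ → ℕ → Prop := fun k i => (k < p ∧ k < i) ∨ (p ≤ k ∧ i < k)
  let red : ℕ → ℕ → Prop := fun k i => k = n ∨ arc k i
  let Fix : Fin (n + 1) → Set (Sym2 V) := fun c => {e | ∃ i, i < n ∧ (i = c.val ∨ red c.val i) ∧ e = edge v i}
  let N : Fin (n + 1) → Set (Sym2 V) := fun c => {e | ∃ i, i < n ∧ red c.val i ∧ e = edge v i}
  let mem : Fin (n + 1) → Set (Sym2 V) → Prop := fun c ω => ∀ e ∈ Fix c, (e ∈ ω ↔ e ∈ N c)
  have hedge_inj : ∀ {i i' : ℕ}, i < n → i' < n → edge v i = edge v i' → i = i' := fun hi hi' h => edge_inj hn hinj hper hi hi' h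
  -- membership in the boxes, spelled out
  have hmemN : ∀ (c : Fin (n + 1)) (i : ℕ), i < n → (edge v i ∈ N c ↔ red c.val i) := by
    intro c i hi
    constructor
    · rintro ⟨i', hi', hred, he⟩
      rwa [hedge_inj hi hi' he]
    · exact fun h => ⟨i, hi, h, rfl⟩
  have hmem_iff : ∀ (c : Fin (n + 1)) (ω : Set (Sym2 V)),
      mem c ω ↔ ((c.val < n → edge v c.val ∉ ω) ∧ ∀ i, i < n → red c.val i → edge v i ∈ ω) := by
    intro c ω
    constructor
    · intro h
      refine ⟨fun hc hcω => ?_, fun i hi hred => ?_⟩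
      · have h1 := (h (edge v c.val) ⟨c.val, hc, Or.inl rfl, rfl⟩).1 hcω
        rw [hmemN c c.val hc] at h1
        rcases h1 with h1 | h1
        · omega
        · rcases h1 with ⟨-, h1⟩ | ⟨-, h1⟩ <;> omega
      · exact (h (edge v i) ⟨i, hi, Or.inr hred, rfl⟩).2 ((hmemN c i hi).2 hred)
    · rintro ⟨hblue, hreds⟩ e ⟨i, hi, hor, rfl⟩
      rw [hmemN c i hi]
      rcases hor with rfl | hred
      · constructor
        · exact fun h => absurd h (hblue hi)
        · intro h
          rcases h with h | h
          · omega
          · rcases h with ⟨-, h⟩ | ⟨-, h⟩ <;> omega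
      · exact iff_of_true (hreds i hi hred) hred
  -- pairs off the cycle are never fixed
  have hFix_sub : ∀ (c : Fin (n + 1)) (e : Sym2 V), e ∈ Fix c → e ∈ edgeSet n v := by
    rintro c e ⟨i, hi, -, rfl⟩
    exact ⟨i, hi, rfl⟩
  have hstub_free : ∀ (c : Fin (n + 1)) (i : ℕ), i < j → s(w i, w (i + 1)) ∉ Fix c := by
    intro c i hi hmem
    have hdiag := hfresh (i + 1) (Nat.succ_pos i) (by omega) _ (hFix_sub c _ hmem) (Sym2.mem_mk_right _ _)
    rw [Sym2.mk_isDiag_iff] at hdiag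
    have := hwinj i (i + 1) (by omega) (by omega) hdiag
    omega
  -- the event on `E_j` is the event on the cycle
  have hPiff : ∀ ω : Set (Sym2 V), v p ∈ openCluster (ω ∩ (edgeSet n v ∪ edgeSet j w)) (v 0) ↔
      v p ∈ openCluster (ω ∩ edgeSet n v) (v 0) := fun ω => Box.mem_path_iff hfresh hwinj hsw hj ω hPw
  refine Box.boxes_sum_nonneg (edgeSet n v ∪ edgeSet j w) (v 0) _ Fix N ?_ ?_ ?_ ?_ hK₁ hso₁ hK₂ hso₂
  · -- cover
    intro ω hω
    have hP := (hPiff ω).1 (Finset.mem_filter.1 hω).2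
    rcases oplus_cover hn hinj hper hp0 hpn ω hP with htop | ⟨k, hk, hbk, hbox⟩
    · refine ⟨⟨n, Nat.lt_succ_self n⟩, (hmem_iff _ ω).2 ⟨fun h => absurd h (lt_irrefl n), fun i hi _ => htop i hi⟩⟩
    · refine ⟨⟨k, Nat.lt_succ_of_lt hk⟩, (hmem_iff _ ω).2 ⟨fun _ => hbk, fun i hi hred => ?_⟩⟩
      rcases hred with h | h
      · exact absurd h (Nat.ne_of_lt hk)
      · exact hbox i hi h
  · -- inside
    intro c ω hmem
    rw [Finset.mem_filter, hPiff ω]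
    refine ⟨Finset.mem_univ _, ?_⟩
    obtain ⟨hblue, hreds⟩ := (hmem_iff c ω).1 hmem
    by_cases hc : c.val < n
    · exact mem_X_of_box hn hinj hper hp0 hpn ω hc fun i hi harc => hreds i hi (Or.inr harc)
    · have hcn : c.val = n := by have := c.isLt; omega
      exact mem_X_of_top hn hinj hper hp0 hpn ω fun i hi => hreds i hi (Or.inl hcn)
  · -- uniqueness
    intro c c' ω hmem hmem'
    obtain ⟨hblue, hreds⟩ := (hmem_iff c ω).1 hmem
    obtain ⟨hblue', hreds'⟩ := (hmem_iff c' ω).1 hmem'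
    apply Fin.ext
    by_cases hc : c.val < n
    · by_cases hc' : c'.val < n
      · exact box_uniq (p := p) ω hc hc' (hblue hc) (fun i hi harc => hreds i hi (Or.inr harc)) (hblue' hc')
          (fun i hi harc => hreds' i hi (Or.inr harc))
      · have hcn' : c'.val = n := by have := c'.isLt; omega
        exact absurd (hreds' c.val hc (Or.inl hcn')) (hblue hc)
    · have hcn : c.val = n := by have := c.isLt; omega
      by_cases hc' : c'.val < n
      · exact absurd (hreds c'.val hc' (Or.inl hcn)) (hblue' hc')
      · have hcn' : c'.val = n := by have := c'.isLt; omega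
        rw [hcn, hcn']
  · -- red domination: on the cycle by `dom_box` / `dom_top`, then along the stub by `Box.dom_path`
    intro c ω ω' hmem hmem' hflip
    obtain ⟨hblue, hreds⟩ := (hmem_iff c ω).1 hmem
    obtain ⟨hblue', hreds'⟩ := (hmem_iff c ω').1 hmem'
    refine Box.dom_path hfresh hwinj hsw hj (fun i hi => hflip _ (hstub_free c i hi)) ?_
    by_cases hc : c.val < n
    · refine dom_box hn hinj hper ω ω' (k := c.val) (red c.val) ?_ hreds hreds' fun i hi hik hnred => ?_
      · by_cases hkp : c.val < p
        · exact Or.inl ⟨by omega, fun i hki hin => Or.inr (Or.inl ⟨hkp, hki⟩)⟩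
        · exact Or.inr ⟨by omega, fun i hik => Or.inr (Or.inr ⟨by omega, hik⟩)⟩
      · refine hflip (edge v i) fun hmemF => ?_
        obtain ⟨i', hi', hor, he⟩ := hmemF
        rw [hedge_inj hi hi' he] at hik hnred
        rcases hor with h | h
        · exact hik h
        · exact hnred h
    · have hcn : c.val = n := by have := c.isLt; omega
      exact dom_top hn hinj hper ω ω' fun i hi => hreds' i hi (Or.inl hcn)

end Cyc

end Antithetic

end Summit.CriticalPhenomena.PercolationContinuityZ3.Theorems
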